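import Literature.NumberTheory.Sieve.FGKMT2018Prop91EDiffCounting
import Literature.NumberTheory.Sieve.FGKMT2018Prop91MainTermL84
import Literature.NumberTheory.Sieve.FGKMT2018Prop91LamMaxError
import Literature.NumberTheory.Sieve.Maynard2016DenseClustersMixedProfile
import HarnessLib

/-!
# [Maynard2016DenseClusters, Prop. 9.1] for `𝒜 = ℤ` — the `F₂`-sum by Lemma 8.4 and the assembly of (7.12)

The leaf `Maynard2016DenseClusters_prop91Z` of the Prop. 6.1 decomposition
(`Maynard2016Prop61Decomposition`) is the estimate
`|∑_{X<n≤2X} w_n − c·P·(log R)^k I_k(F)| ≪ (log X)^{−1/10} · main term` in the frame of Prop. 6.1.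
The printed proof (pp. 19–20) splits `∑_n w_n = c(∑_r y_r²/φ_ω(r) + E_diff) + O(λ_max² |𝒟|²)`:

* the main term `c P² Σ^{(k)} = (1 + O((log X)^{−1/10})) · mainTermA` is `FGKMT2018.prop91_mainTerm_frame`
  (Lemma 8.4, `FGKMT2018Prop91MainTermL84`);
* the `λ_max`-error is `FGKMT2018.prop91_lamErr_le_mainTermA` (`FGKMT2018Prop91LamMaxError`);
* `E_diff` is reduced in `FGKMT2018Prop91EDiffPointwise` / `FGKMT2018Prop91EDiffCounting` (Lemma 8.2, the
  count «`∏(ω(p) − 1)` choices», the regrouping `r = r'p` and `∑_{p>2k²} log p/p²`) to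
  `|E_diff| ≤ 12 log 4 · (30 + 30/U_k + T_k) P²/(k log R) · S_w`, `S_w = ∑_{r ∈ 𝒟_k} F₂(u(r))² w(∏r)`,
  `w(m) = ∏_{q∣m}(q + k − 2)/φ_ω(m)²`.

PART 1 records the remaining printed input as the named statement `Maynard2016Prop91SwBound`
(`P · S_w ≤ K k² (log R)^k I_k(F)` in the frame; «Lemma 8.4 shows the right hand side is
`≪ k T_k (log R)^{−1}` times the main term», p. 20, with Lemma 8.6) and proves the assembly
`Maynard2016Prop91SwBound → Maynard2016DenseClusters_prop91Z` (`maynard2016DenseClusters_prop91Z_of_swBound`):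
the relative error is `K₂ (log X)^{−1/10}` (main term) `+ (log X)^{−1/10}` (`λ_max`)
`+ 36 log 4 · K₁ k² log k/log R ≤ 8640 log 4 · K₁ (log X)^{−1/10}` (`E_diff`, using `k ≤ (log x)^{1/5}`,
`R ≥ X^{1/30}`).

PART 2 PROVES `Maynard2016Prop91SwBound` (`maynard2016Prop91SwBound_holds`) and hence the leaf
(`maynard2016DenseClusters_prop91Z_holds`):
* `F₂(u(r))² ≤ k² ∏ᵢ G̃(log rᵢ/log R²)` with the one-variable profile `G̃ = mixG²` of
  `Maynard2016DenseClustersMixedProfile` (`F₂ ≤ k ∏ᵢ (g_k + h_k/k)`), so `S_w` is at most `k²` times the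
  `r`-fold sum (8.9) of Lemma 8.4 at scale `R²` with `Φ ≡ 1` and the multiplicative weight
  `A_w(p) = (p − ω(p))²/(p + k − 2)` (`1/∏_{p∣m} A_w(p) = w(m)`);
* one application of Lemma 8.4 (`lemma84_all'_dec`; `Ω_G/I_G ≪ T_k²`, `L ≪ (log X)^{1/10}` by
  `lambda84_le_gen`) gives `≤ 3 Π_w (log R)^k (2 I_G)^k ≤ 6 e⁴ Π_w (log R)^k I_k(F)`;
* the Euler products compare factor by factor: `Π_w ≤ 4¹² Π`, and `P · Π = excProd ≤ 2` (the singular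
  series cancel, `FGKMT2018Prop91PiIdentification`).

## References
* J. Maynard, *Dense clusters of primes in subsets*, Compositio Math. 152 (2016); arXiv:1405.2593,
  Prop. 9.1 with proof pp. 19–20, Lemmas 8.2, 8.4, 8.6. [Maynard2016DenseClusters]
* K. Ford, B. Green, S. Konyagin, J. Maynard, T. Tao, *Long gaps between primes*, J. Amer. Math. Soc. 31
  (2018); arXiv:1412.5029, Theorem 6 (7.12) pp. 21–22. [FordGreenKonyaginMaynardTao2018]
-/

noncomputable section

open Finset Filter Real
open scoped Topology

namespace Literature.NumberTheory.Sieve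

/-- **[Maynard2016DenseClusters, proof of Prop. 9.1 p. 20, the appeal to Lemma 8.4 for the `E_diff` sum]**
(named statement, used as a hypothesis): in the frame of Prop. 6.1,
`P · ∑_{r ∈ 𝒟_k(𝓛)} F₂(u(r))² w(∏rᵢ) ≤ K k² (log R)^k I_k(F)`, where
`P = (WB)^k 𝔖_{WB}(𝓛)/φ(WB)^k` (`yPref`), `u(r)ᵢ = log rᵢ/log R`, `w(m) = ∏_{q∣m}(q+k−2)/φ_ω(m)²` (`wRatio`)
and `F₂` is the function of (7.6). Printed: «Lemma 8.4 shows the right hand side is `≪ k T_k/log R` times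
the main term» (`k` one-dimensional sums of Lemma 8.3 for the profile `h_k²`, `k − 1` for `g_k²`, and
`I_k(F₂) ≤ 4k² I_k(F)` of Lemma 8.6).
[cite: Maynard2016DenseClusters, proof of Prop. 9.1 p. 20 («By Lemma 8.4 … ≪ k T_k (log R)^{-1} …»), Lemma 8.4, Lemma 8.6] -/
def Maynard2016Prop91SwBound : Prop :=
  ∃ (C : ℕ) (K : ℝ), 0 < K ∧ FGKMT2018.Prop61Frame C fun B k L _X R =>
    FGKMT2018.yPref L B *
        ∑ r ∈ FGKMT2018.dkBox L B R,
          MaynardDense.F₂ k (FGKMT2018.logVec R r) ^ 2 * FGKMT2018.wRatio L (∏ i, r i) ≤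
      K * (k : ℝ) ^ 2 * Real.log R ^ k * MaynardDense.IF k

namespace FGKMT2018

variable {k : ℕ}

/-- `P = (WB)^k 𝔖_{WB}/φ(WB)^k` unfolded. [cite: Maynard2016DenseClusters, Lemma 8.1 (the factor of y_r)] -/
theorem yPref_def (L : Fin k → ℤ × ℤ) (B : ℕ) :
    yPref L B = ((wCut k B * B : ℕ) : ℝ) ^ k / (Nat.totient (wCut k B * B) : ℝ) ^ k *
      singSeriesExcl L (wCut k B * B) := rfl

/-- `k² log k/log R ≤ 240 (log X)^{−1/10}` from `k³ log²k ≤ 8 (log X)^{4/5}`, `log X ≤ 30 log R`, `k ≥ 3`.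
[cite: Maynard2016DenseClusters, proof of Prop. 9.1 p. 20 («k T_k (log R)^{-1}» is o(1) for k ≤ (log x)^{1/5})] -/
theorem sq_mul_log_div_log_le (hk : 3 ≤ k) {X R : ℝ} (hlX1 : 1 ≤ Real.log X)
    (hk3X : (k : ℝ) ^ 3 * Real.log k ^ 2 ≤ 8 * Real.log X ^ ((4 : ℝ) / 5))
    (hlogXR : Real.log X ≤ 30 * Real.log R) (hR : 1 < R) :
    (k : ℝ) ^ 2 * Real.log k / Real.log R ≤ 240 / Real.log X ^ ((1 : ℝ) / 10) := by
  have hlX0 : 0 < Real.log X := by linarith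
  have hlogR : 0 < Real.log R := Real.log_pos hR
  set u : ℝ := Real.log X ^ ((1 : ℝ) / 10) with hu
  have hu1 : 1 ≤ u := Real.one_le_rpow hlX1 (by norm_num)
  have hu0 : 0 < u := by linarith
  have hk0 : (0 : ℝ) < k := by exact_mod_cast lt_of_lt_of_le (by norm_num) hk
  have hlogk : 1 ≤ Real.log k := by
    rw [← Real.log_exp 1]
    refine Real.log_le_log (Real.exp_pos 1) ?_
    have h3 : (3 : ℝ) ≤ k := by exact_mod_cast hk
    exact le_trans (le_of_lt (lt_trans Real.exp_one_lt_d9 (by norm_num))) h3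
  -- `k² log k ≤ k³ log² k`
  have h1 : (k : ℝ) ^ 2 * Real.log k ≤ (k : ℝ) ^ 3 * Real.log k ^ 2 := by
    have hk1 : (1 : ℝ) ≤ k := by exact_mod_cast le_trans (by norm_num) hk
    have : (k : ℝ) ^ 2 * Real.log k * 1 ≤ (k : ℝ) ^ 2 * Real.log k * ((k : ℝ) * Real.log k) :=
      mul_le_mul_of_nonneg_left (by nlinarith) (by positivity)
    nlinarith
  -- `u² (log X)^{4/5} = log X`
  have hu2 : u ^ 2 * Real.log X ^ ((4 : ℝ) / 5) = Real.log X := by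
    rw [hu, ← Real.rpow_natCast, ← Real.rpow_mul hlX0.le, ← Real.rpow_add hlX0]
    norm_num
  have h2 : (k : ℝ) ^ 2 * Real.log k * u ^ 2 ≤ 240 * Real.log R := by
    calc (k : ℝ) ^ 2 * Real.log k * u ^ 2 ≤ (k : ℝ) ^ 3 * Real.log k ^ 2 * u ^ 2 :=
          mul_le_mul_of_nonneg_right h1 (sq_nonneg _)
      _ ≤ 8 * Real.log X ^ ((4 : ℝ) / 5) * u ^ 2 := mul_le_mul_of_nonneg_right hk3X (sq_nonneg _)
      _ = 8 * Real.log X := by rw [mul_assoc, mul_comm (Real.log X ^ ((4 : ℝ) / 5)), hu2]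
      _ ≤ 240 * Real.log R := by linarith
  rw [div_le_div_iff₀ hlogR hu0]
  have h3 : (k : ℝ) ^ 2 * Real.log k * u ≤ (k : ℝ) ^ 2 * Real.log k * u ^ 2 := by
    have : u ≤ u ^ 2 := by nlinarith
    exact mul_le_mul_of_nonneg_left this (by positivity)
  linarith

end FGKMT2018

set_option maxHeartbeats 800000 in
open FGKMT2018 in
/-- **[Maynard2016DenseClusters, Prop. 9.1 for `𝒜 = ℤ`] assembled modulo `Maynard2016Prop91SwBound`**:
the reduction `abs_sum_sieveWt_sub_rFoldSum_le` (Lemma 8.1, the support of `T_{δ,e}`), the main term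
`prop91_mainTerm_frame` (Lemma 8.4), the `λ_max`-error `prop91_lamErr_le_mainTermA` (Lemma 8.5(i)) and the
`E_diff` reduction `abs_ediff_le_sum_F₂_sq_wRatio` (Lemma 8.2, p. 20) give the leaf
`Maynard2016DenseClusters_prop91Z` with `K = K_main + 1 + 8640 log 4 · K_{S_w}`.
[cite: Maynard2016DenseClusters, Prop. 9.1 with proof pp. 19–20; FordGreenKonyaginMaynardTao2018, Thm 6 (7.12) pp. 21–22] -/
theorem maynard2016DenseClusters_prop91Z_of_swBound (hSw : Maynard2016Prop91SwBound) :
    Maynard2016DenseClusters_prop91Z := by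
  classical
  obtain ⟨C₁, K₁, hK₁, h₁⟩ := hSw
  obtain ⟨C₂, K₂, hK₂, h₂⟩ := FGKMT2018.prop91_mainTerm_frame
  obtain ⟨C₃, h₃⟩ := FGKMT2018.prop91_lamErr_le_mainTermA
  have hlog4 : 0 < Real.log 4 := Real.log_pos (by norm_num)
  refine ⟨max (max (max C₁ C₂) C₃) 262144, K₂ + 1 + 8640 * Real.log 4 * K₁, by positivity, ?_⟩
  have h123 := (h₁.and h₂).and h₃
  unfold FGKMT2018.Prop61Frame at h123 ⊢
  filter_upwards [h123, FGKMT2018.eventually_prop91_main_aux 1] with x hx123 hx B hB hBx k L X R hCk hk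
    hadm hnd hcoef hX1 hX2 hR1 hR2
  have hC123 : max (max C₁ C₂) C₃ ≤ k := (le_max_left _ _).trans hCk
  have hk18 : 262144 ≤ k := (le_max_right _ _).trans hCk
  obtain ⟨⟨hS, hM⟩, hlam⟩ := hx123 B hB hBx k L X R hC123 hk hadm hnd hcoef hX1 hX2 hR1 hR2
  obtain ⟨hXone, hlX1, -, -, hk3X, hlogXR, hR2'⟩ := hx k hk X R hX1 hR1
  have hk2 : 2 ≤ k := le_trans (by norm_num) hk18
  have hk3 : 3 ≤ k := le_trans (by norm_num) hk18
  have hk0 : (0 : ℝ) < k := by exact_mod_cast (show 0 < k by omega)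
  have hB0 : B ≠ 0 := hB.elim (fun h => by rw [h]; exact one_ne_zero) fun h => h.ne_zero
  have hR1' : 1 < R := by linarith
  have hlX0 : 0 < Real.log X := by linarith
  have hlogR : 0 < Real.log R := Real.log_pos hR1'
  -- the pieces
  have hred := FGKMT2018.abs_sum_sieveWt_sub_rFoldSum_le hk2 X hadm B hR1'
  have hE := FGKMT2018.abs_ediff_le_sum_F₂_sq_wRatio hadm hnd hk2 hB0 hR1'
  rw [← FGKMT2018.yPref_def L B] at hred hM
  -- abbreviations
  set W := wCut k B with hW
  set P : ℝ := FGKMT2018.yPref L B with hP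
  set Srf : ℝ := MaynardDense.rFoldSum k (FGKMT2018.idxMod L B R) (fun p => (p : ℝ) - omegaL L p)
    (fun x => MaynardDense.psi x ^ 2) (fun t => MaynardDense.profExt k t ^ 2) R 0 with hSrf
  set c : ℝ := (#(dyadZ X) : ℝ) * phiOmega L W / (W : ℝ) with hc
  set Ed : ℝ := ∑ r ∈ FGKMT2018.dkBox L B R, ∑ s ∈ FGKMT2018.dkBox L B R,
      FGKMT2018.yVar L B R (MaynardDense.F k) r *
          (FGKMT2018.yVar L B R (MaynardDense.F k) s - FGKMT2018.yVar L B R (MaynardDense.F k) r) /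
        phiOmega L (∏ i, r i) ^ 2 * FGKMT2018.localPairSum L B R r s with hEd
  set Sw : ℝ := ∑ r ∈ FGKMT2018.dkBox L B R,
      MaynardDense.F₂ k (FGKMT2018.logVec R r) ^ 2 * FGKMT2018.wRatio L (∏ i, r i) with hSwdef
  set lamE : ℝ := phiOmega L W *
      (∑ d ∈ FGKMT2018.dkBox L B R, |FGKMT2018.lamVar L B R (MaynardDense.F k) d|) ^ 2 with hlamE
  set Sn : ℝ := ∑ n ∈ dyadZ X, FGKMT2018.sieveWt L B R (MaynardDense.F k) n with hSn
  set M : ℝ := mainTermA L B X R (MaynardDense.IF k) with hMdef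
  set u : ℝ := Real.log X ^ ((1 : ℝ) / 10) with hu
  set CT : ℝ := 30 + 30 / MaynardDense.U k + MaynardDense.T k with hCT
  -- positivity
  have hu1 : 1 ≤ u := Real.one_le_rpow hlX1 (by norm_num)
  have hu0 : 0 < u := by linarith
  have hIF : 0 < MaynardDense.IF k := MaynardDense.orthantI_F_pos hk18
  have hP0 : 0 < P := FGKMT2018.yPref_pos hadm hnd (le_trans (by norm_num) hk2) hB0
  have hφω : 0 < phiOmega L W :=
    FGKMT2018.phiOmega_pos_of_forall_lt L fun p hp =>
      ((FGKMT2018.formsAdmissible_iff_omegaL L).1 hadm).2 p (Nat.prime_of_mem_primeFactors hp)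
  have hc0 : 0 ≤ c := by positivity
  have hSw0 : 0 ≤ Sw := Finset.sum_nonneg fun r _ =>
    mul_nonneg (sq_nonneg _) (FGKMT2018.wRatio_nonneg (le_trans (by norm_num) hk2) L _)
  have hT : 0 < MaynardDense.T k := MaynardDense.T_pos hk2
  have hCT3 : CT ≤ 3 * MaynardDense.T k := MaynardDense.shift_const_le hk18
  have hCT0 : 0 ≤ CT := by
    have hU : 0 < MaynardDense.U k := by unfold MaynardDense.U; positivity
    rw [hCT]; positivity
  -- the main term is `c · P · (log R)^k I_k(F)`
  have hmain : M = c * P * (Real.log R ^ k * MaynardDense.IF k) := by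
    rw [hMdef, mainTermA, ← FGKMT2018.mainTerm_prefactor_eq hadm hnd B, hc, hP, FGKMT2018.yPref_def]
    ring
  have hM0 : 0 ≤ M := by rw [hmain]; positivity
  -- `k² log k/log R ≤ 240/u`
  have hkr : (k : ℝ) ^ 2 * Real.log k / Real.log R ≤ 240 / u :=
    FGKMT2018.sq_mul_log_div_log_le hk3 hlX1 hk3X hlogXR hR1'
  -- `|c E_diff| ≤ 8640 log 4 · K₁/u · M`
  have hTk : 3 * MaynardDense.T k / ((k : ℝ) * Real.log R) = 3 * Real.log k / Real.log R := by
    rw [MaynardDense.T, show (3 : ℝ) * ((k : ℝ) * Real.log k) = (k : ℝ) * (3 * Real.log k) by ring,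
      mul_div_mul_left _ _ hk0.ne']
  have hcEd : |c * Ed| ≤ 8640 * Real.log 4 * K₁ / u * M := by
    rw [abs_mul, abs_of_nonneg hc0]
    have hPSw : P * Sw ≤ K₁ * (k : ℝ) ^ 2 * Real.log R ^ k * MaynardDense.IF k := hS
    calc c * |Ed| ≤ c * (12 * Real.log 4 * (CT * P ^ 2 / (k * Real.log R)) * Sw) :=
          mul_le_mul_of_nonneg_left hE hc0
      _ = 12 * Real.log 4 * c * (CT / (k * Real.log R)) * (P * (P * Sw)) := by ring
      _ ≤ 12 * Real.log 4 * c * (3 * MaynardDense.T k / (k * Real.log R)) *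
            (P * (K₁ * (k : ℝ) ^ 2 * Real.log R ^ k * MaynardDense.IF k)) := by
          apply mul_le_mul
          · exact mul_le_mul_of_nonneg_left (div_le_div_of_nonneg_right hCT3 (by positivity))
              (by positivity)
          · exact mul_le_mul_of_nonneg_left hPSw hP0.le
          · positivity
          · positivity
      _ = 36 * Real.log 4 * K₁ * ((k : ℝ) ^ 2 * Real.log k / Real.log R) *
            (c * P * (Real.log R ^ k * MaynardDense.IF k)) := by
          rw [hTk]; ring
      _ = 36 * Real.log 4 * K₁ * ((k : ℝ) ^ 2 * Real.log k / Real.log R) * M := by rw [hmain]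
      _ ≤ 36 * Real.log 4 * K₁ * (240 / u) * M :=
          mul_le_mul_of_nonneg_right (mul_le_mul_of_nonneg_left hkr (by positivity)) hM0
      _ = 8640 * Real.log 4 * K₁ / u * M := by ring
  -- the `λ_max` error
  have hlamE : lamE ≤ 1 / u * M := hlam
  -- assemble
  calc |Sn - M| ≤ |Sn - c * (P ^ 2 * Srf)| + |c * (P ^ 2 * Srf) - M| := abs_sub_le _ _ _
    _ ≤ (|c * Ed| + lamE) + K₂ / u * M := add_le_add hred hM
    _ ≤ (8640 * Real.log 4 * K₁ / u * M + 1 / u * M) + K₂ / u * M :=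
        add_le_add (add_le_add hcEd hlamE) le_rfl
    _ = (K₂ + 1 + 8640 * Real.log 4 * K₁) / u * M := by ring


/-! ## PART 2 — the `F₂`-sum `S_w` by Lemma 8.4 at scale `R²` -/

open MeasureTheory

namespace FGKMT2018

variable {k : ℕ}

/-! ## §1 The multiplicative weight `A_w(p) = (p − ω(p))²/(p + k − 2)` -/

/-- `A_w(p) = (p − ω_𝓛(p))²/(p + k − 2)`: the function `g` of Lemma 8.4 for which `1/∏_{p∣m} g(p)` is the
`E_diff` weight `w(m) = ∏_{p∣m}(p + k − 2)/φ_ω(m)²`. [cite: Maynard2016DenseClusters, proof of Prop. 9.1 p. 20 (the E_diff sum «is ≪ … by Lemma 8.4»), Lemma 8.4 (8.9)] -/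
def awFun (L : Fin k → ℤ × ℤ) (p : ℕ) : ℝ := ((p : ℝ) - omegaL L p) ^ 2 / ((p : ℝ) + k - 2)

/-- `A_w(p) ≥ 0` (`k ≥ 2`). [cite: Maynard2016DenseClusters, proof of Prop. 9.1 p. 20] -/
theorem awFun_nonneg (hk : 2 ≤ k) (L : Fin k → ℤ × ℤ) (p : ℕ) : 0 ≤ awFun L p := by
  have hk' : (2 : ℝ) ≤ k := by exact_mod_cast hk
  have hp : (0 : ℝ) ≤ p := Nat.cast_nonneg p
  exact div_nonneg (sq_nonneg _) (by linarith)

/-- `A_w(p) > 0` at primes, for admissible `𝓛` (`ω(p) < p`). [cite: Maynard2016DenseClusters, §7 p. 13, proof of Prop. 9.1 p. 20] -/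
theorem awFun_pos (hk : 2 ≤ k) {L : Fin k → ℤ × ℤ} (hadm : FormsAdmissible L) {p : ℕ} (hp : p.Prime) :
    0 < awFun L p := by
  have hk' : (2 : ℝ) ≤ k := by exact_mod_cast hk
  have hp2 : (2 : ℝ) ≤ p := by exact_mod_cast hp.two_le
  exact div_pos (pow_pos (sub_omegaL_pos hadm hp) 2) (by linarith)

/-- `|1 + A_w(p) − p| + k ≤ k²` at primes (`k ≥ 4`): the hypothesis `K₁ ≤ K₀²` of the decoupled Lemma 8.4
with `K₀ = k`. [cite: Maynard2016DenseClusters, Lemma 8.3/8.4 (hypothesis g(p) = p + O(k)), proof of Prop. 9.1 p. 20] -/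
theorem abs_one_add_awFun_sub_le (hk : 4 ≤ k) {L : Fin k → ℤ × ℤ} (hadm : FormsAdmissible L) {p : ℕ}
    (hp : p.Prime) : |1 + awFun L p - p| + (k : ℝ) ≤ (k : ℝ) ^ 2 := by
  have hk' : (4 : ℝ) ≤ k := by exact_mod_cast hk
  have hω : ((omegaL L p : ℕ) : ℝ) ≤ k := by
    exact_mod_cast omegaL_le_card_of_admissible hadm hp
  have hωp : ((omegaL L p : ℕ) : ℝ) + 1 ≤ p := by
    have : omegaL L p < p := ((formsAdmissible_iff_omegaL L).1 hadm).2 p hp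
    exact_mod_cast this
  have hω0 : (0 : ℝ) ≤ (omegaL L p : ℕ) := Nat.cast_nonneg _
  have hp2 : (2 : ℝ) ≤ p := by exact_mod_cast hp.two_le
  set a : ℝ := (p : ℝ) - omegaL L p with ha
  have ha1 : 1 ≤ a := by rw [ha]; linarith
  have hD : 0 < (p : ℝ) + k - 2 := by linarith
  have hAw : awFun L p = a ^ 2 / ((p : ℝ) + k - 2) := by rw [awFun, ← ha]
  -- `A_w ≤ a ≤ p`
  have hup : awFun L p ≤ a := by
    rw [hAw, div_le_iff₀ hD]
    have : a ≤ (p : ℝ) + k - 2 := by rw [ha]; linarith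
    nlinarith
  -- `p − A_w ≤ 3k`
  have hlow : (p : ℝ) - 3 * k ≤ awFun L p := by
    rw [hAw, le_div_iff₀ hD]
    have : ((p : ℝ) - 3 * k) * ((p : ℝ) + k - 2) ≤ a ^ 2 := by
      rw [ha]; nlinarith
    exact this
  have habs : |1 + awFun L p - p| ≤ 3 * k - 1 := by
    rw [abs_le]; constructor <;> linarith
  nlinarith

/-! ## §2 `1/∏_{p∣m} A_w(p) = w(m)` and the Lemma-8.4 weight on `𝒟_k` -/

/-- On `𝒟_k(𝓛)` the Lemma-8.4 weight for `A_w` is `w(∏r) = ∏_{p∣r}(p + k − 2)/φ_ω(r)²`.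
[cite: Maynard2016DenseClusters, proof of Prop. 9.1 p. 20, Lemma 8.4 (8.9)] -/
theorem rWeight_awFun_eq_wRatio {L : Fin k → ℤ × ℤ} {B : ℕ} {R : ℝ} {e : Fin k → ℕ} (he : e ∈ dkBox L B R) :
    MaynardDense.rWeight k (idxMod L B R) (awFun L) e = wRatio L (∏ i, e i) := by
  classical
  have hcond := (mem_dkBox_iff_coprime_idxMod (dkBox_subset_piFinset L B R he)).1 he
  unfold MaynardDense.rWeight
  rw [if_pos hcond, wRatio, phiOmega, ← Finset.prod_pow, ← Finset.prod_div_distrib, ← Finset.prod_inv_distrib]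
  refine Finset.prod_congr rfl fun p _ => ?_
  rw [awFun, inv_div]

/-- The Lemma-8.4 weight for `A_w` is `≥ 0`. [cite: Maynard2016DenseClusters, Lemma 8.4 (8.9)] -/
theorem rWeight_awFun_nonneg (hk : 2 ≤ k) (L : Fin k → ℤ × ℤ) (W : Fin k → ℕ) (e : Fin k → ℕ) :
    0 ≤ MaynardDense.rWeight k W (awFun L) e := by
  unfold MaynardDense.rWeight
  split_ifs
  · exact inv_nonneg.2 (Finset.prod_nonneg fun p _ => awFun_nonneg hk L p)
  · exact le_rfl

/-! ## §3 `F₂(u(r))² ≤ k² ∏ mixG(log rᵢ/log R²)²` and the sum as an `r`-fold sum at scale `R²` -/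

/-- **`F₂(u(r))² ≤ k² ∏ᵢ mixG_k(log rᵢ/log R²)²`** (`rᵢ ≥ 1`, `R > 1`).
[cite: Maynard2016DenseClusters, (7.6), proof of Prop. 9.1 p. 20] -/
theorem F₂_sq_le_prod_mixG_sq (hk : 2 ≤ k) {R : ℝ} (hR : 1 < R) {r : Fin k → ℕ} (hr : ∀ i, 1 ≤ r i) :
    MaynardDense.F₂ k (logVec R r) ^ 2 ≤
      (k : ℝ) ^ 2 * ∏ i, MaynardDense.mixG k (MaynardDense.uOf (R ^ 2) (r i)) ^ 2 := by
  have hlogR : 0 < Real.log R := Real.log_pos hR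
  have horth : logVec R r ∈ MaynardDense.orthant k := logVec_mem_orthant hR.le r hr
  have h1 := MaynardDense.F₂_le_mul_prod_mix hk horth
  have h0 := MaynardDense.F₂_nonneg hk horth
  have hu : ∀ i, MaynardDense.uOf (R ^ 2) (r i) = logVec R r i / 2 := fun i => by
    simp only [MaynardDense.uOf, logVec, Real.log_pow]
    push_cast
    field_simp
  have h2 : ∏ i, (MaynardDense.prof k (logVec R r i) + MaynardDense.prof₂ k (logVec R r i) / k) =
      ∏ i, MaynardDense.mixG k (MaynardDense.uOf (R ^ 2) (r i)) :=
    Finset.prod_congr rfl fun i _ => by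
      rw [hu i, MaynardDense.mixG_half hk (MaynardDense.mem_orthant.1 horth i)]
  calc MaynardDense.F₂ k (logVec R r) ^ 2
      ≤ ((k : ℝ) * ∏ i, (MaynardDense.prof k (logVec R r i) + MaynardDense.prof₂ k (logVec R r i) / k)) ^ 2 :=
        pow_le_pow_left₀ h0 h1 2
    _ = (k : ℝ) ^ 2 * ∏ i, MaynardDense.mixG k (MaynardDense.uOf (R ^ 2) (r i)) ^ 2 := by
        rw [h2, mul_pow, Finset.prod_pow]

/-- **`∑_{r ∈ 𝒟_k} F₂(u(r))² w(∏r) ≤ k² · Σ^{(k)}(W⃗; A_w; 1, mixG²)(R²)`**: the `E_diff` sum is dominated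
by `k²` times an `r`-fold sum (8.9) of Lemma 8.4 at scale `R²`.
[cite: Maynard2016DenseClusters, proof of Prop. 9.1 p. 20 («Lemma 8.4 shows the right hand side is ≪ …»), Lemma 8.4 (8.9)] -/
theorem sum_F₂_sq_wRatio_le_rFoldSum (hk : 2 ≤ k) (L : Fin k → ℤ × ℤ) (B : ℕ) {R : ℝ} (hR : 1 < R) :
    ∑ r ∈ dkBox L B R, MaynardDense.F₂ k (logVec R r) ^ 2 * wRatio L (∏ i, r i) ≤
      (k : ℝ) ^ 2 * MaynardDense.rFoldSum k (idxMod L B R) (awFun L) (fun _ => 1)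
        (fun s => MaynardDense.mixG k s ^ 2) (R ^ 2) 0 := by
  classical
  have hR2 : 1 < R ^ 2 := by nlinarith
  have hG1 : ∀ t : ℝ, 1 ≤ t → MaynardDense.mixG k t ^ 2 = 0 := fun t ht => by
    rw [MaynardDense.mixG_eq_zero hk ht]; ring
  rw [← MaynardDense.sum_piFinset_Icc_eq_rFoldSum k (idxMod L B R) (awFun L) (fun _ => (1 : ℝ)) hG1 hR2 0,
    Finset.mul_sum]
  have hsub : dkBox L B R ⊆ Fintype.piFinset fun _ : Fin k => Finset.Icc 1 ⌊R ^ 2⌋₊ := by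
    intro e he
    have he' := Fintype.mem_piFinset.1 (dkBox_subset_piFinset L B R he)
    rw [Fintype.mem_piFinset]
    intro i
    have h := Finset.mem_Icc.1 (he' i)
    rw [Finset.mem_Icc]
    exact ⟨h.1, h.2.trans (Nat.floor_le_floor (by nlinarith))⟩
  have hpt : ∀ r ∈ dkBox L B R,
      MaynardDense.F₂ k (logVec R r) ^ 2 * wRatio L (∏ i, r i) ≤
        (k : ℝ) ^ 2 * (MaynardDense.rWeight k (idxMod L B R) (awFun L) r *
          ((fun _ : ℝ => (1 : ℝ)) (0 + ∑ i, MaynardDense.uOf (R ^ 2) (r i)) *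
            ∏ i, (fun s => MaynardDense.mixG k s ^ 2) (MaynardDense.uOf (R ^ 2) (r i)))) := by
    intro r hr
    have hr1 : ∀ i, 1 ≤ r i := one_le_of_mem_dkBox hr
    rw [rWeight_awFun_eq_wRatio hr]
    simp only [one_mul]
    have hw := wRatio_nonneg (le_trans (by norm_num) hk) L (∏ i, r i)
    calc MaynardDense.F₂ k (logVec R r) ^ 2 * wRatio L (∏ i, r i)
        ≤ ((k : ℝ) ^ 2 * ∏ i, MaynardDense.mixG k (MaynardDense.uOf (R ^ 2) (r i)) ^ 2) *
            wRatio L (∏ i, r i) := mul_le_mul_of_nonneg_right (F₂_sq_le_prod_mixG_sq hk hR hr1) hw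
      _ = (k : ℝ) ^ 2 * (wRatio L (∏ i, r i) *
            ∏ i, MaynardDense.mixG k (MaynardDense.uOf (R ^ 2) (r i)) ^ 2) := by ring
  have hnn : ∀ e ∈ Fintype.piFinset (fun _ : Fin k => Finset.Icc 1 ⌊R ^ 2⌋₊), e ∉ dkBox L B R →
      0 ≤ (k : ℝ) ^ 2 * (MaynardDense.rWeight k (idxMod L B R) (awFun L) e *
          ((fun _ : ℝ => (1 : ℝ)) (0 + ∑ i, MaynardDense.uOf (R ^ 2) (e i)) *
            ∏ i, (fun s => MaynardDense.mixG k s ^ 2) (MaynardDense.uOf (R ^ 2) (e i)))) := by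
    intro e _ _
    simp only [one_mul]
    exact mul_nonneg (sq_nonneg _) (mul_nonneg (rWeight_awFun_nonneg hk L _ e)
      (Finset.prod_nonneg fun i _ => sq_nonneg _))
  exact (Finset.sum_le_sum hpt).trans (Finset.sum_le_sum_of_subset_of_nonneg hsub hnn)

/-! ## §4 `Π_w ≤ 4¹² Π`: comparison of the Euler products -/

/-- `#{j : p ∤ W_j} ≤ k`. [cite: Maynard2016DenseClusters, Lemma 8.4 (definition of n(p))] -/
theorem nW_le (W : Fin k → ℕ) (p : ℕ) : MaynardDense.nW k W p ≤ k := by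
  classical
  unfold MaynardDense.nW
  calc ∑ i : Fin k, (if p ∣ W i then 0 else 1) ≤ ∑ _i : Fin k, 1 :=
        Finset.sum_le_sum fun i _ => by split_ifs <;> simp
    _ = k := by simp

/-- **Termwise comparison** at a prime `p > 2k²`: `1 + n/A_w(p) ≤ (1 + 8k²/p²)(1 + n/(p − ω(p)))`
(`0 ≤ n ≤ k`). [cite: Maynard2016DenseClusters, Lemma 8.4 (Π_g = ∏(1 + n(p)/g(p))(1 − 1/p)^r), proof of Prop. 9.1 p. 20] -/
theorem one_add_div_awFun_le (hk : 2 ≤ k) {L : Fin k → ℤ × ℤ} (hadm : FormsAdmissible L) {p : ℕ}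
    (hp : p.Prime) (h2k : 2 * k ^ 2 < p) {n : ℝ} (hn0 : 0 ≤ n) (hnk : n ≤ k) :
    1 + n / awFun L p ≤ (1 + 8 * (k : ℝ) ^ 2 / (p : ℝ) ^ 2) * (1 + n / ((p : ℝ) - omegaL L p)) := by
  have hkr : (2 : ℝ) ≤ k := by exact_mod_cast hk
  have hω : ((omegaL L p : ℕ) : ℝ) ≤ k := by exact_mod_cast omegaL_le_card_of_admissible hadm hp
  have ha0 : 0 < (p : ℝ) - omegaL L p := sub_omegaL_pos hadm hp
  have hω0 : (0 : ℝ) ≤ (omegaL L p : ℕ) := Nat.cast_nonneg _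
  have hp2k : (2 : ℝ) * (k : ℝ) ^ 2 < p := by exact_mod_cast h2k
  set a : ℝ := (p : ℝ) - omegaL L p with ha
  have hkp : 2 * (k : ℝ) ≤ p := by nlinarith
  have h2a : (p : ℝ) ≤ 2 * a := by rw [ha]; linarith
  have hp0 : (0 : ℝ) < p := by linarith
  have hc0 : 0 ≤ ((omegaL L p : ℕ) : ℝ) + k - 2 := by linarith
  have hD0 : a + (((omegaL L p : ℕ) : ℝ) + k - 2) ≠ 0 := by
    have : 0 < a + (((omegaL L p : ℕ) : ℝ) + k - 2) := by linarith
    exact this.ne'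
  have hsplit : n / awFun L p = n / a + n * (((omegaL L p : ℕ) : ℝ) + k - 2) / a ^ 2 := by
    have hD : (p : ℝ) + k - 2 = a + (((omegaL L p : ℕ) : ℝ) + k - 2) := by rw [ha]; ring
    rw [awFun, ← ha, hD]
    field_simp
  have hkey : n * (((omegaL L p : ℕ) : ℝ) + k - 2) / a ^ 2 ≤ 8 * (k : ℝ) ^ 2 / (p : ℝ) ^ 2 := by
    rw [div_le_div_iff₀ (by positivity) (by positivity)]
    have h1 : n * (((omegaL L p : ℕ) : ℝ) + k - 2) ≤ 2 * (k : ℝ) ^ 2 := by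
      have : ((omegaL L p : ℕ) : ℝ) + k - 2 ≤ 2 * k := by linarith
      calc n * (((omegaL L p : ℕ) : ℝ) + k - 2) ≤ k * (2 * k) := mul_le_mul hnk this hc0 (by linarith)
        _ = 2 * (k : ℝ) ^ 2 := by ring
    have h2 : (p : ℝ) ^ 2 ≤ 4 * a ^ 2 := by nlinarith
    calc n * (((omegaL L p : ℕ) : ℝ) + k - 2) * (p : ℝ) ^ 2 ≤ 2 * (k : ℝ) ^ 2 * (p : ℝ) ^ 2 :=
          mul_le_mul_of_nonneg_right h1 (by positivity)
      _ ≤ 2 * (k : ℝ) ^ 2 * (4 * a ^ 2) := mul_le_mul_of_nonneg_left h2 (by positivity)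
      _ = 8 * (k : ℝ) ^ 2 * a ^ 2 := by ring
  rw [hsplit]
  have hx : 0 ≤ 8 * (k : ℝ) ^ 2 / (p : ℝ) ^ 2 := by positivity
  have hy : 0 ≤ n / a := by positivity
  nlinarith [mul_nonneg hx hy]

/-- `∑_{2k² < p < y, p prime} 8k²/p² ≤ 12 log 4`. [cite: RosserSchoenfeld1962, Thm 9 (θ(x) < 2x log 2); Maynard2016DenseClusters, proof of Prop. 9.1 p. 20] -/
theorem sum_ite_div_sq_le (hk : 2 ≤ k) (y : ℕ) :
    ∑ p ∈ Nat.primesBelow y, (if 2 * k ^ 2 < p then 8 * (k : ℝ) ^ 2 / (p : ℝ) ^ 2 else 0) ≤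
      12 * Real.log 4 := by
  classical
  have hk0 : (0 : ℝ) < k := by exact_mod_cast lt_of_lt_of_le (by norm_num) hk
  have hk2sq : 2 ≤ 2 * k ^ 2 := by nlinarith
  rw [← Finset.sum_filter]
  have hlit := MaynardDense.sum_filter_prime_gt_log_div_sq_le hk2sq
    ((Nat.primesBelow y).filter fun p => 2 * k ^ 2 < p)
  rw [Finset.filter_true_of_mem (s := (Nat.primesBelow y).filter fun p => 2 * k ^ 2 < p)
    (p := fun p => p.Prime ∧ 2 * k ^ 2 < p) (fun p hp => by
      obtain ⟨hp1, hp2⟩ := Finset.mem_filter.1 hp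
      exact ⟨(Nat.mem_primesBelow.1 hp1).2, hp2⟩)] at hlit
  have hterm : ∀ p ∈ (Nat.primesBelow y).filter (fun p => 2 * k ^ 2 < p),
      8 * (k : ℝ) ^ 2 / (p : ℝ) ^ 2 ≤ 8 * (k : ℝ) ^ 2 * (Real.log p / (p : ℝ) ^ 2) := by
    intro p hp
    obtain ⟨hp1, hp2⟩ := Finset.mem_filter.1 hp
    have h8 : 2 * k ^ 2 < p := hp2
    have hp8 : (8 : ℝ) < p := by
      have : (2 : ℝ) * (k : ℝ) ^ 2 < p := by exact_mod_cast h8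
      have hk2r : (2 : ℝ) ≤ k := by exact_mod_cast hk
      nlinarith
    have hlogp : 1 ≤ Real.log p := by
      rw [Real.le_log_iff_exp_le (by linarith)]
      have := Real.exp_one_lt_d9
      linarith
    rw [mul_div_assoc']
    exact div_le_div_of_nonneg_right (by nlinarith) (by positivity)
  calc ∑ p ∈ (Nat.primesBelow y).filter (fun p => 2 * k ^ 2 < p), 8 * (k : ℝ) ^ 2 / (p : ℝ) ^ 2
      ≤ ∑ p ∈ (Nat.primesBelow y).filter (fun p => 2 * k ^ 2 < p),
          8 * (k : ℝ) ^ 2 * (Real.log p / (p : ℝ) ^ 2) := Finset.sum_le_sum hterm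
    _ = 8 * (k : ℝ) ^ 2 * ∑ p ∈ (Nat.primesBelow y).filter (fun p => 2 * k ^ 2 < p),
          Real.log p / (p : ℝ) ^ 2 := by rw [Finset.mul_sum]
    _ ≤ 8 * (k : ℝ) ^ 2 * (3 * Real.log 4 / ((2 * k ^ 2 : ℕ) : ℝ)) :=
        mul_le_mul_of_nonneg_left hlit (by positivity)
    _ = 12 * Real.log 4 := by push_cast; field_simp; ring

/-- **The partial Euler products compare**: `∏_{p<y}(1 + n(p)/A_w(p))(1 − 1/p)^k ≤ 4¹² ∏_{p<y}(1 + n(p)/(p − ω(p)))(1 − 1/p)^k`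
(`n(p) = 0` for `p ≤ 2k²`; `∏_{p > 2k²}(1 + 8k²/p²) ≤ e^{12 log 4}`).
[cite: Maynard2016DenseClusters, Lemma 8.4 (definition of Π_g), proof of Prop. 9.1 p. 20] -/
theorem piPartial_awFun_le (hk : 2 ≤ k) {L : Fin k → ℤ × ℤ} (hadm : FormsAdmissible L) (B : ℕ) (R : ℝ)
    (y : ℕ) :
    MaynardDense.piPartial k (idxMod L B R) (awFun L) y ≤
      (4 : ℝ) ^ 12 * MaynardDense.piPartial k (idxMod L B R) (fun p => (p : ℝ) - omegaL L p) y := by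
  classical
  unfold MaynardDense.piPartial
  set W := idxMod L B R with hW
  set c : ℕ → ℝ := fun p => if 2 * k ^ 2 < p then 1 + 8 * (k : ℝ) ^ 2 / (p : ℝ) ^ 2 else 1 with hc
  have hc1 : ∀ p, 1 ≤ c p := fun p => by
    by_cases h : 2 * k ^ 2 < p
    · rw [show c p = 1 + 8 * (k : ℝ) ^ 2 / (p : ℝ) ^ 2 from if_pos h]
      have : 0 ≤ 8 * (k : ℝ) ^ 2 / (p : ℝ) ^ 2 := by positivity
      linarith
    · rw [show c p = 1 from if_neg h]
  have hfac0 : ∀ p ∈ Nat.primesBelow y, 0 ≤ (1 - 1 / (p : ℝ)) ^ k := fun p hp => by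
    have hpp : p.Prime := (Nat.mem_primesBelow.1 hp).2
    have hp1 : (1 : ℝ) ≤ p := by exact_mod_cast hpp.one_lt.le
    exact pow_nonneg (by rw [sub_nonneg, div_le_one (by linarith)]; exact hp1) k
  have hterm : ∀ p ∈ Nat.primesBelow y,
      (1 + (MaynardDense.nW k W p : ℝ) / awFun L p) * (1 - 1 / (p : ℝ)) ^ k ≤
        c p * ((1 + (MaynardDense.nW k W p : ℝ) / ((p : ℝ) - omegaL L p)) * (1 - 1 / (p : ℝ)) ^ k) := by
    intro p hp
    have hpp : p.Prime := (Nat.mem_primesBelow.1 hp).2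
    have hq := hfac0 p hp
    by_cases h2k : 2 * k ^ 2 < p
    · rw [show c p = 1 + 8 * (k : ℝ) ^ 2 / (p : ℝ) ^ 2 from if_pos h2k]
      have hn0 : (0 : ℝ) ≤ MaynardDense.nW k W p := Nat.cast_nonneg _
      have hnk : (MaynardDense.nW k W p : ℝ) ≤ k := by exact_mod_cast nW_le W p
      have h := one_add_div_awFun_le hk hadm hpp h2k hn0 hnk
      calc (1 + (MaynardDense.nW k W p : ℝ) / awFun L p) * (1 - 1 / (p : ℝ)) ^ k
          ≤ ((1 + 8 * (k : ℝ) ^ 2 / (p : ℝ) ^ 2) * (1 + (MaynardDense.nW k W p : ℝ) / ((p : ℝ) - omegaL L p))) *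
              (1 - 1 / (p : ℝ)) ^ k := mul_le_mul_of_nonneg_right h hq
        _ = _ := by ring
    · rw [not_lt] at h2k
      have hn : MaynardDense.nW k W p = 0 := by
        unfold MaynardDense.nW
        exact Finset.sum_eq_zero fun i _ => if_pos (hW ▸ dvd_idxMod_of_le L B R i hpp h2k)
      rw [show c p = 1 from if_neg (not_lt.2 h2k), hn]
      simp
  have hnonneg : ∀ p ∈ Nat.primesBelow y,
      0 ≤ (1 + (MaynardDense.nW k W p : ℝ) / awFun L p) * (1 - 1 / (p : ℝ)) ^ k := fun p hp =>
    mul_nonneg (add_nonneg zero_le_one (div_nonneg (Nat.cast_nonneg _) (awFun_nonneg hk L p))) (hfac0 p hp)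
  have hnonneg' : ∀ p ∈ Nat.primesBelow y,
      0 ≤ (1 + (MaynardDense.nW k W p : ℝ) / ((p : ℝ) - omegaL L p)) * (1 - 1 / (p : ℝ)) ^ k := fun p hp =>
    mul_nonneg (add_nonneg zero_le_one (div_nonneg (Nat.cast_nonneg _)
      (sub_omegaL_pos hadm (Nat.mem_primesBelow.1 hp).2).le)) (hfac0 p hp)
  -- `∏ c(p) ≤ exp(∑ 8k²/p²) ≤ 4¹²`
  have hcprod : ∏ p ∈ Nat.primesBelow y, c p ≤ (4 : ℝ) ^ 12 := by
    have h1 : ∀ p ∈ Nat.primesBelow y,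
        c p ≤ Real.exp (if 2 * k ^ 2 < p then 8 * (k : ℝ) ^ 2 / (p : ℝ) ^ 2 else 0) := by
      intro p _
      by_cases h : 2 * k ^ 2 < p
      · rw [show c p = 1 + 8 * (k : ℝ) ^ 2 / (p : ℝ) ^ 2 from if_pos h, if_pos h]
        have := Real.add_one_le_exp (8 * (k : ℝ) ^ 2 / (p : ℝ) ^ 2)
        linarith
      · rw [show c p = 1 from if_neg h, if_neg h, Real.exp_zero]
    have h12 : (12 : ℝ) * Real.log 4 = Real.log ((4 : ℝ) ^ 12) := by
      rw [Real.log_pow]; norm_num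
    calc ∏ p ∈ Nat.primesBelow y, c p
        ≤ ∏ p ∈ Nat.primesBelow y, Real.exp (if 2 * k ^ 2 < p then 8 * (k : ℝ) ^ 2 / (p : ℝ) ^ 2 else 0) :=
          Finset.prod_le_prod (fun p _ => zero_le_one.trans (hc1 p)) h1
      _ = Real.exp (∑ p ∈ Nat.primesBelow y, if 2 * k ^ 2 < p then 8 * (k : ℝ) ^ 2 / (p : ℝ) ^ 2 else 0) := by
          rw [Real.exp_sum]
      _ ≤ Real.exp (12 * Real.log 4) := Real.exp_le_exp.2 (sum_ite_div_sq_le hk y)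
      _ = (4 : ℝ) ^ 12 := by rw [h12, Real.exp_log (by positivity)]
  calc ∏ p ∈ Nat.primesBelow y, (1 + (MaynardDense.nW k W p : ℝ) / awFun L p) * (1 - 1 / (p : ℝ)) ^ k
      ≤ ∏ p ∈ Nat.primesBelow y,
          (c p * ((1 + (MaynardDense.nW k W p : ℝ) / ((p : ℝ) - omegaL L p)) * (1 - 1 / (p : ℝ)) ^ k)) :=
        Finset.prod_le_prod hnonneg hterm
    _ = (∏ p ∈ Nat.primesBelow y, c p) *
          ∏ p ∈ Nat.primesBelow y, ((1 + (MaynardDense.nW k W p : ℝ) / ((p : ℝ) - omegaL L p)) *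
            (1 - 1 / (p : ℝ)) ^ k) := Finset.prod_mul_distrib
    _ ≤ (4 : ℝ) ^ 12 * ∏ p ∈ Nat.primesBelow y,
          ((1 + (MaynardDense.nW k W p : ℝ) / ((p : ℝ) - omegaL L p)) * (1 - 1 / (p : ℝ)) ^ k) :=
        mul_le_mul_of_nonneg_right hcprod (Finset.prod_nonneg hnonneg')

/-- **`Π_w ≤ 4¹² Π`**: the constant of Lemma 8.4 for the weight `A_w` is at most `4¹²` times the one for
`A = p − ω(p)` (both are the limits of their partial Euler products, `tendsto_piPartial_dec`).
[cite: Maynard2016DenseClusters, Lemma 8.4 (Π_g), proof of Prop. 9.1 p. 20] -/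
theorem piRec_awFun_le (hk : 4 ≤ k) {L : Fin k → ℤ × ℤ} (hadm : FormsAdmissible L) {B : ℕ} (hB : B ≠ 0)
    (R : ℝ) :
    MaynardDense.piRec k (idxMod L B R) (awFun L) ≤
      (4 : ℝ) ^ 12 * MaynardDense.piRec k (idxMod L B R) (fun p => (p : ℝ) - omegaL L p) := by
  have hk2 : 2 ≤ k := le_trans (by norm_num) hk
  have hk2r : (2 : ℝ) ≤ k := by exact_mod_cast hk2
  have hT1 := MaynardDense.tendsto_piPartial_dec k (idxMod L B R) k ((k : ℝ) ^ 2) (awFun L) hk2r le_rfl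
    (fun i => idxMod_ne_zero L hB R i) (fun i p hp hle => dvd_idxMod_of_real_le L B R i hp hle)
    (fun p hp => awFun_pos hk2 hadm hp) (fun p hp => abs_one_add_awFun_sub_le hk hadm hp)
  have hT2 := MaynardDense.tendsto_piPartial_dec k (idxMod L B R) k (2 * (k : ℝ) - 1)
    (fun p => (p : ℝ) - omegaL L p) hk2r (by nlinarith [sq_nonneg ((k : ℝ) - 1)])
    (fun i => idxMod_ne_zero L hB R i) (fun i p hp hle => dvd_idxMod_of_real_le L B R i hp hle)
    (fun p hp => sub_omegaL_pos hadm hp) (fun p hp => abs_dev_omegaL_add_le hk2 hadm hp)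
  exact le_of_tendsto_of_tendsto' hT1 (hT2.const_mul _) fun y => piPartial_awFun_le hk2 hadm B R y

/-! ## §5 The size hypothesis `L` of Lemma 8.4 at scale `R²` -/

/-- `log 4 ≤ 2`, `log 52 ≤ 4`. [folklore] -/
private theorem log_four_le_two_and_log_52_le_four' : Real.log 4 ≤ 2 ∧ Real.log 52 ≤ 4 := by
  have h := Real.exp_one_gt_d9
  have h0 := Real.exp_pos (1 : ℝ)
  have he2 : Real.exp 2 = Real.exp 1 * Real.exp 1 := by rw [← Real.exp_add]; norm_num
  have h2 : (7389 : ℝ) / 1000 ≤ Real.exp 2 := by rw [he2]; nlinarith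
  constructor
  · rw [Real.log_le_iff_le_exp (by norm_num)]
    linarith
  · rw [Real.log_le_iff_le_exp (by norm_num)]
    have : Real.exp 4 = Real.exp 2 * Real.exp 2 := by rw [← Real.exp_add]; norm_num
    rw [this]; nlinarith [Real.exp_pos (2 : ℝ)]

/-- **The hypothesis `L` of Lemma 8.4 at a general scale**: for `M ≤ W_i N^k` with `N ≤ 2X` and
`W_i ≤ W B E ≤ x^{O(k²)}`: `9 + ∑_{p∣M} log p/p ≤ 29 (log X)^{1/10}` (as `lambda84_le`, with `⌈R⌉`
replaced by any `N ≤ 2X`; used with `N = ⌈R²⌉`). [cite: Maynard2016DenseClusters, Lemma 8.4 (hypothesis on L(e)), proof of Prop. 9.1 p. 20; Lemma 8.1(ii)] -/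
theorem lambda84_le_gen (hk : 2 ≤ k) {L : Fin k → ℤ × ℤ} {B : ℕ} (hB0 : B ≠ 0) {R X : ℝ} {E N : ℕ}
    (hX : 1 ≤ X) (hlX : 1 ≤ Real.log X) (hkX : (k : ℝ) ^ 2 ≤ 2 * Real.log X ^ ((2 : ℝ) / 5))
    (hBX : (B : ℝ) ≤ 2 * X) (hE1 : 1 ≤ E) (hlogE : Real.log E ≤ 20 * (k : ℝ) ^ 2 * Real.log X)
    (hWi : ∀ i, idxMod L B R i ≤ wCut k B * B * E) (hN1 : 1 ≤ N) (hNX : (N : ℝ) ≤ 2 * X) (i : Fin k)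
    {M : ℕ} (hM : M ≠ 0) (hMle : (M : ℝ) ≤ (idxMod L B R i : ℝ) * (N : ℝ) ^ k) :
    9 + ∑ p ∈ M.primeFactors, Real.log p / p ≤ 29 * Real.log X ^ ((1 : ℝ) / 10) := by
  obtain ⟨hlog4, hlog52⟩ := log_four_le_two_and_log_52_le_four'
  set lX := Real.log X with hlXdef
  have hlX0 : 0 < lX := by linarith
  set u := lX ^ ((1 : ℝ) / 10) with hu
  have hu1 : 1 ≤ u := Real.one_le_rpow hlX (by norm_num)
  have hk2r : (2 : ℝ) ≤ k := by exact_mod_cast hk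
  have hk4 : (4 : ℝ) ≤ (k : ℝ) ^ 2 := by nlinarith
  have hX0 : 0 < X := by linarith
  have hlog2X : Real.log (2 * X) ≤ 2 * lX := by
    rw [Real.log_mul (by norm_num) hX0.ne', hlXdef]
    have : Real.log 2 ≤ 1 := by have := Real.log_two_lt_d9; linarith
    linarith
  have hW1 : (1 : ℝ) ≤ (wCut k B : ℝ) := by exact_mod_cast Nat.one_le_iff_ne_zero.2 (wCut_ne_zero k B)
  have hB1 : (1 : ℝ) ≤ (B : ℝ) := by exact_mod_cast Nat.one_le_iff_ne_zero.2 hB0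
  have hE1r : (1 : ℝ) ≤ (E : ℝ) := by exact_mod_cast hE1
  have hC1 : (1 : ℝ) ≤ (N : ℝ) := by exact_mod_cast hN1
  have hlogW : Real.log (wCut k B : ℝ) ≤ 4 * (k : ℝ) ^ 2 * lX := by
    have h1 : (wCut k B : ℝ) ≤ (4 : ℝ) ^ (2 * k ^ 2) := by exact_mod_cast wCut_le_four_pow k B
    calc Real.log (wCut k B : ℝ) ≤ Real.log ((4 : ℝ) ^ (2 * k ^ 2)) := Real.log_le_log (by linarith) h1
      _ = (2 * k ^ 2 : ℕ) * Real.log 4 := by rw [Real.log_pow]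
      _ ≤ (2 * k ^ 2 : ℕ) * 2 := mul_le_mul_of_nonneg_left hlog4 (Nat.cast_nonneg _)
      _ = 4 * (k : ℝ) ^ 2 * 1 := by push_cast; ring
      _ ≤ 4 * (k : ℝ) ^ 2 * lX := mul_le_mul_of_nonneg_left hlX (by positivity)
  have hlogB : Real.log (B : ℝ) ≤ (k : ℝ) ^ 2 * lX := by
    calc Real.log (B : ℝ) ≤ Real.log (2 * X) := Real.log_le_log (by linarith) hBX
      _ ≤ 2 * lX := hlog2X
      _ ≤ (k : ℝ) ^ 2 * lX := mul_le_mul_of_nonneg_right (by linarith) hlX0.le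
  have hlogC : (k : ℝ) * Real.log (N : ℝ) ≤ (k : ℝ) ^ 2 * lX := by
    have h1 : Real.log (N : ℝ) ≤ 2 * lX := (Real.log_le_log (by linarith) hNX).trans hlog2X
    calc (k : ℝ) * Real.log (N : ℝ) ≤ (k : ℝ) * (2 * lX) := mul_le_mul_of_nonneg_left h1 (by linarith)
      _ = 2 * (k : ℝ) * lX := by ring
      _ ≤ (k : ℝ) ^ 2 * lX := mul_le_mul_of_nonneg_right (by nlinarith) hlX0.le
  have hM0 : (0 : ℝ) < M := by exact_mod_cast Nat.pos_of_ne_zero hM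
  have hMle' : (M : ℝ) ≤ (wCut k B : ℝ) * B * E * (N : ℝ) ^ k := by
    have h1 : (idxMod L B R i : ℝ) ≤ (wCut k B : ℝ) * B * E := by exact_mod_cast hWi i
    exact hMle.trans (mul_le_mul_of_nonneg_right h1 (by positivity))
  have hlogM : Real.log M ≤ 26 * (k : ℝ) ^ 2 * lX := by
    have hpos : (0 : ℝ) < (wCut k B : ℝ) * B * E * (N : ℝ) ^ k := by positivity
    calc Real.log M ≤ Real.log ((wCut k B : ℝ) * B * E * (N : ℝ) ^ k) := Real.log_le_log hM0 hMle'
      _ = Real.log (wCut k B : ℝ) + Real.log B + Real.log E + k * Real.log (N : ℝ) := by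
          rw [Real.log_mul (by positivity) (by positivity), Real.log_mul (by positivity) (by positivity),
            Real.log_mul (by positivity) (by positivity), Real.log_pow]
      _ ≤ 4 * (k : ℝ) ^ 2 * lX + (k : ℝ) ^ 2 * lX + 20 * (k : ℝ) ^ 2 * lX + (k : ℝ) ^ 2 * lX := by
          linarith
      _ = 26 * (k : ℝ) ^ 2 * lX := by ring
  have h75 : lX ^ ((2 : ℝ) / 5) * lX = lX ^ ((7 : ℝ) / 5) := by
    rw [← Real.rpow_add_one hlX0.ne']; norm_num
  have hlogM' : Real.log M ≤ 52 * lX ^ ((7 : ℝ) / 5) := by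
    calc Real.log M ≤ 26 * (k : ℝ) ^ 2 * lX := hlogM
      _ ≤ 26 * (2 * lX ^ ((2 : ℝ) / 5)) * lX :=
          mul_le_mul_of_nonneg_right (mul_le_mul_of_nonneg_left hkX (by norm_num)) hlX0.le
      _ = 52 * lX ^ ((7 : ℝ) / 5) := by rw [← h75]; ring
  set T := 52 * lX ^ ((13 : ℝ) / 10) with hT
  have hT1 : 1 ≤ lX ^ ((13 : ℝ) / 10) := Real.one_le_rpow hlX (by norm_num)
  have hTpos : 0 < T := by rw [hT]; positivity
  have hT3 : 3 ≤ T := by rw [hT]; linarith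
  have hsum := sum_primeFactors_log_div_le hM hT3
  have hdiv : Real.log M / T ≤ u := by
    rw [div_le_iff₀ hTpos, hu, hT]
    have : lX ^ ((1 : ℝ) / 10) * (52 * lX ^ ((13 : ℝ) / 10)) = 52 * lX ^ ((7 : ℝ) / 5) := by
      rw [mul_left_comm, ← Real.rpow_add hlX0]; norm_num
    rw [this]; exact hlogM'
  have hlogT : Real.log T ≤ 4 + 13 * u := by
    rw [hT, Real.log_mul (by norm_num) (by positivity), Real.log_rpow hlX0]
    have h1 : Real.log lX ≤ lX ^ ((1 : ℝ) / 10) / ((1 : ℝ) / 10) := Real.log_le_rpow_div hlX0.le (by norm_num)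
    rw [hu]
    have : (13 : ℝ) / 10 * Real.log lX ≤ 13 * lX ^ ((1 : ℝ) / 10) := by
      have := mul_le_mul_of_nonneg_left h1 (by norm_num : (0 : ℝ) ≤ 13 / 10)
      linarith
    linarith
  linarith

/-! ## §6 The `E_diff` sum in the frame of Proposition 6.1, and Proposition 9.1 -/

set_option maxHeartbeats 1600000 in
/-- **The `E_diff` sum by Lemma 8.4** (Maynard p. 20: «Lemma 8.4 shows the right hand side is
`≪ (y²_max φ(B)^k 𝔖_B #𝒜 (log R)^k/B^k)(k T_k (log R)^{−1} I_k(F))`», combined with Lemma 8.2's gain as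
packaged in `Maynard2016Prop91SwBound`): in the ranges of Prop. 6.1, for `k ≥ 2¹⁸`,
`P · ∑_{r ∈ 𝒟_k} F₂(u(r))² w(∏r) ≤ 12 e⁴ 4¹² · k² (log R)^k I_k(F)`.
[cite: Maynard2016DenseClusters, proof of Prop. 9.1 p. 20, Lemma 8.4 p. 16, Lemma 8.6 p. 18; FordGreenKonyaginMaynardTao2018, Thm 6 (7.12) pp. 21–22] -/
theorem prop91_swBound_frame :
    ∃ (C : ℕ) (K : ℝ), 0 < K ∧ Prop61Frame C fun B k L _X R =>
      yPref L B * ∑ r ∈ dkBox L B R, MaynardDense.F₂ k (logVec R r) ^ 2 * wRatio L (∏ i, r i) ≤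
        K * (k : ℝ) ^ 2 * Real.log R ^ k * MaynardDense.IF k := by
  obtain ⟨C84, hC0, h84⟩ := MaynardDense.lemma84_all'_dec
  set CE : ℝ := 1294560 * C84 with hCE
  have hCE0 : 0 ≤ CE := by positivity
  refine ⟨262144, 12 * Real.exp 4 * 4 ^ 12, by positivity, ?_⟩
  have hfr := prop91_excProd_frame
  unfold Prop61Frame at hfr ⊢
  filter_upwards [hfr, eventually_prop91_main_aux (CE + 1)] with x hxE hx B hB hBx k L X R hCk hk hadm
    hnd hcoef hX1 hX2 hR1 hR2
  obtain ⟨E, hE1, hE, hlogE, -, hPiE, hex1, hex2⟩ :=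
    hxE B hB hBx k L X R (le_trans (by norm_num) hCk) hk hadm hnd hcoef hX1 hX2 hR1 hR2
  obtain ⟨hXone, hlX1, hKbig, hk2X, hk3X, hlogXR, hR2'⟩ := hx k hk X R hX1 hR1
  have hk2 : 2 ≤ k := le_trans (by norm_num) hCk
  have hk4 : 4 ≤ k := le_trans (by norm_num) hCk
  have hk0 : (0 : ℝ) < k := by exact_mod_cast (show 0 < k by omega)
  have hB0 : B ≠ 0 := hB.elim (fun h => by rw [h]; exact one_ne_zero) fun h => h.ne_zero
  have hlX0 : 0 < Real.log X := by linarith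
  have hX0 : 0 < X := by linarith
  have hR1' : 1 < R := by linarith
  have hlogR : 0 < Real.log R := Real.log_pos hR1'
  have hR2sq : 2 ≤ R ^ 2 := by nlinarith
  have hlR2 : Real.log (R ^ 2) = 2 * Real.log R := by rw [Real.log_pow]; push_cast; ring
  -- `R² ≤ X`
  have hR2X : R ^ 2 ≤ X := by
    have h1 : R ≤ X ^ ((1 : ℝ) / 2) :=
      hR2.trans (Real.rpow_le_rpow_of_exponent_le hXone (by norm_num))
    have h2 : R ^ 2 ≤ (X ^ ((1 : ℝ) / 2)) ^ 2 := pow_le_pow_left₀ (by linarith) h1 2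
    rw [← Real.rpow_natCast (X ^ ((1 : ℝ) / 2)) 2, ← Real.rpow_mul hX0.le] at h2
    norm_num at h2
    exact h2
  rw [yPref_def]
  -- abbreviations
  set W := wCut k B with hW
  set A : ℕ → ℝ := fun p => (p : ℝ) - omegaL L p with hA
  set P : ℝ := ((W * B : ℕ) : ℝ) ^ k / (Nat.totient (W * B) : ℝ) ^ k * singSeriesExcl L (W * B) with hP
  set Pi : ℝ := MaynardDense.piRec k (idxMod L B R) A with hPi
  set Piw : ℝ := MaynardDense.piRec k (idxMod L B R) (awFun L) with hPiw
  set S₂ : ℝ := MaynardDense.rFoldSum k (idxMod L B R) (awFun L) (fun _ => 1)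
    (fun s => MaynardDense.mixG k s ^ 2) (R ^ 2) 0 with hS₂
  set IG : ℝ := ∫ u in Set.Ici (0 : ℝ), MaynardDense.mixG k u ^ 2 with hIG
  set LI : ℝ := Real.log R ^ k * MaynardDense.IF k with hLI
  set ex : ℝ := excProd L (W * B) ⌊R⌋₊ E with hex
  set u : ℝ := Real.log X ^ ((1 : ℝ) / 10) with hu
  -- positivity
  have hu1 : 1 ≤ u := Real.one_le_rpow hlX1 (by norm_num)
  have hu0 : 0 < u := by linarith
  have hIF : 0 < MaynardDense.IF k := MaynardDense.orthantI_F_pos hCk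
  have hLI0 : 0 ≤ LI := by positivity
  have hP0 : 0 < P := yPref_pos hadm hnd (by omega) hB0
  have hγ : 0 < MaynardDense.gam k := MaynardDense.gam_pos hk2
  have hIGγ : MaynardDense.gam k / 2 ≤ IG := MaynardDense.half_gam_le_setIntegral_mixG_sq hk2
  have hIG0 : 0 < IG := lt_of_lt_of_le (by positivity) hIGγ
  -- Step A: the sum is `≤ k² S₂`
  have hsum := sum_F₂_sq_wRatio_le_rFoldSum hk2 L B hR1'
  -- Step B: Lemma 8.4 at scale `R²` with `G = mixG²`, `Φ ≡ 1`, `A = A_w`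
  obtain ⟨hG1, hG2, hG3, hG4, hG5⟩ := MaynardDense.lemma84_hypG_mixSq hk2
  set Λ : ℝ := 29 * u with hΛ
  set Gs : ℝ := MaynardDense.GsMix k with hGs
  have hGs0 : 0 ≤ Gs := le_trans (by positivity) (hG5 0 ⟨le_rfl, zero_le_one⟩)
  have hWi : ∀ i, idxMod L B R i ≤ W * B * E := fun i =>
    idxMod_le_mul_exceptional hadm B R i (by omega) hE
  have hBX : (B : ℝ) ≤ 2 * X := by
    have : (B : ℝ) ≤ x := by exact_mod_cast hBx
    linarith
  have hN1 : 1 ≤ ⌈R ^ 2⌉₊ := Nat.one_le_iff_ne_zero.2 (Nat.ceil_pos.2 (by positivity)).ne'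
  have hNX : ((⌈R ^ 2⌉₊ : ℕ) : ℝ) ≤ 2 * X := by
    have := Nat.ceil_lt_add_one (show (0 : ℝ) ≤ R ^ 2 by positivity)
    linarith
  have hΛhyp : ∀ i, ∀ M : ℕ, M ≠ 0 → (M : ℝ) ≤ (idxMod L B R i : ℝ) * (⌈R ^ 2⌉₊ : ℝ) ^ k →
      9 + ∑ p ∈ M.primeFactors, Real.log p / p ≤ Λ := fun i M hM hMle =>
    lambda84_le_gen hk2 hB0 hXone hlX1 hk2X hBX hE1 hlogE hWi hN1 hNX i hM hMle
  -- `k ε ≤ CE/(log X)^{1/10} ≤ 1`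
  have hGsb : Gs ≤ 186 * ((k : ℝ) * Real.log k) ^ 2 * MaynardDense.gam k := by
    have h1 := MaynardDense.GsMix_le hk2
    have h2 := two_mul_Gs_le hCk
    rw [hGs]
    nlinarith [h1, h2, hγ]
  have hkGs : (k : ℝ) * Gs ≤ 1488 * Real.log X ^ ((4 : ℝ) / 5) * MaynardDense.gam k := by
    calc (k : ℝ) * Gs ≤ (k : ℝ) * (186 * ((k : ℝ) * Real.log k) ^ 2 * MaynardDense.gam k) :=
          mul_le_mul_of_nonneg_left hGsb hk0.le
      _ = 186 * ((k : ℝ) ^ 3 * Real.log k ^ 2) * MaynardDense.gam k := by ring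
      _ ≤ 186 * (8 * Real.log X ^ ((4 : ℝ) / 5)) * MaynardDense.gam k :=
          mul_le_mul_of_nonneg_right (mul_le_mul_of_nonneg_left hk3X (by norm_num)) hγ.le
      _ = 1488 * Real.log X ^ ((4 : ℝ) / 5) * MaynardDense.gam k := by ring
  have huv : u * Real.log X ^ ((4 : ℝ) / 5) = Real.log X / u := by
    rw [eq_div_iff hu0.ne', hu, ← Real.rpow_add hlX0, ← Real.rpow_add hlX0]
    norm_num
  have hkε : (k : ℝ) * (C84 * Λ * Gs / (IG * Real.log (R ^ 2))) ≤ CE / u := by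
    rw [hlR2]
    have hden : MaynardDense.gam k * Real.log R ≤ IG * (2 * Real.log R) := by nlinarith
    have hden0 : 0 < MaynardDense.gam k * Real.log R := mul_pos hγ hlogR
    have hnum0 : 0 ≤ C84 * Λ * Gs := by positivity
    calc (k : ℝ) * (C84 * Λ * Gs / (IG * (2 * Real.log R)))
        ≤ (k : ℝ) * (C84 * Λ * Gs / (MaynardDense.gam k * Real.log R)) :=
          mul_le_mul_of_nonneg_left (div_le_div_of_nonneg_left hnum0 hden0 hden) hk0.le
      _ = C84 * Λ * ((k : ℝ) * Gs) / (MaynardDense.gam k * Real.log R) := by ring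
      _ ≤ CE / u := by
          rw [div_le_iff₀ hden0]
          calc C84 * Λ * ((k : ℝ) * Gs) ≤ C84 * Λ * (1488 * Real.log X ^ ((4 : ℝ) / 5) * MaynardDense.gam k) :=
                mul_le_mul_of_nonneg_left hkGs (by positivity)
            _ = 1488 * 29 * C84 * (u * Real.log X ^ ((4 : ℝ) / 5)) * MaynardDense.gam k := by rw [hΛ]; ring
            _ = 1488 * 29 * C84 * (Real.log X / u) * MaynardDense.gam k := by rw [huv]
            _ = CE / u * (MaynardDense.gam k * (Real.log X / 30)) := by rw [hCE]; ring
            _ ≤ CE / u * (MaynardDense.gam k * Real.log R) := by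
                apply mul_le_mul_of_nonneg_left _ (by positivity)
                exact mul_le_mul_of_nonneg_left (by linarith) hγ.le
  have hkε1 : (k : ℝ) * (C84 * Λ * Gs / (IG * Real.log (R ^ 2))) ≤ 1 := by
    refine hkε.trans ?_
    rw [div_le_one hu0]
    linarith
  have h := h84 k (idxMod L B R) k ((k : ℝ) ^ 2) (awFun L) (fun s => MaynardDense.mixG k s ^ 2)
    (fun _ => (1 : ℝ)) Gs IG 1 0 Λ (R ^ 2) 0 (by exact_mod_cast hk2) le_rfl
    (fun i => idxMod_ne_zero L hB0 R i) (fun i p hp hle => dvd_idxMod_of_real_le L B R i hp hle)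
    (fun p hp => awFun_pos hk2 hadm hp) (fun p hp => abs_one_add_awFun_sub_le hk4 hadm hp)
    hG1 hG2 hG3 hG4 hG5 hIG.symm hIG0 contDiff_const (fun x => by simp) (fun x => by simp) hR2sq
    hΛhyp hkε1
  obtain ⟨hPiw0, hbd⟩ := h
  have hI : MaynardDense.orthInt k (fun s => MaynardDense.mixG k s ^ 2) (fun _ => (1 : ℝ)) 0 = IG ^ k := by
    rw [MaynardDense.orthInt_one_eq_pow]
  rw [hI] at hbd
  -- `S₂ ≤ 3 Π_w (log R²)^k IG^k`
  set kε : ℝ := (k : ℝ) * (C84 * Λ * Gs / (IG * Real.log (R ^ 2))) with hkεdef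
  have hlR2pos : 0 < Real.log (R ^ 2) := by rw [hlR2]; positivity
  have hX0' : 0 ≤ Piw * Real.log (R ^ 2) ^ k * IG ^ k :=
    mul_nonneg (mul_nonneg hPiw0 (pow_nonneg hlR2pos.le k)) (pow_nonneg hIG0.le k)
  have hS2 : S₂ ≤ 3 * (Piw * Real.log (R ^ 2) ^ k * IG ^ k) := by
    have h1 := (abs_sub_le_iff.1 hbd).1
    have h2 : kε * (Piw * Real.log (R ^ 2) ^ k * IG ^ k) ≤ 1 * (Piw * Real.log (R ^ 2) ^ k * IG ^ k) :=
      mul_le_mul_of_nonneg_right hkε1 hX0'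
    nlinarith
  -- `(log R²)^k IG^k ≤ (log R)^k e⁴ · 2 I_k(F)`
  have hgamIF : MaynardDense.gam k ^ k ≤ 2 * MaynardDense.IF k := by
    have := MaynardDense.orthantI_F_ge_half hCk
    rw [MaynardDense.IF]; linarith
  have hpow : Real.log (R ^ 2) ^ k * IG ^ k ≤ Real.log R ^ k * (Real.exp 4 * (2 * MaynardDense.IF k)) := by
    rw [hlR2, show (2 * Real.log R) ^ k * IG ^ k = Real.log R ^ k * (2 * IG) ^ k by
      rw [mul_pow, mul_pow]; ring]
    refine mul_le_mul_of_nonneg_left ?_ (pow_nonneg hlogR.le k)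
    calc (2 * IG) ^ k ≤ Real.exp 4 * MaynardDense.gam k ^ k :=
          MaynardDense.two_mul_setIntegral_mixG_sq_pow_le hCk
      _ ≤ Real.exp 4 * (2 * MaynardDense.IF k) := mul_le_mul_of_nonneg_left hgamIF (by positivity)
  have hS2' : S₂ ≤ 6 * Real.exp 4 * Piw * LI := by
    calc S₂ ≤ 3 * (Piw * Real.log (R ^ 2) ^ k * IG ^ k) := hS2
      _ = 3 * (Piw * (Real.log (R ^ 2) ^ k * IG ^ k)) := by ring
      _ ≤ 3 * (Piw * (Real.log R ^ k * (Real.exp 4 * (2 * MaynardDense.IF k)))) :=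
          mul_le_mul_of_nonneg_left (mul_le_mul_of_nonneg_left hpow hPiw0) (by norm_num)
      _ = 6 * Real.exp 4 * Piw * LI := by rw [hLI]; ring
  -- Step C: `Π_w ≤ 4¹² Π`; Step D: `P Π = excProd ≤ 2`
  have hPiwle : Piw ≤ (4 : ℝ) ^ 12 * Pi := piRec_awFun_le hk4 hadm hB0 R
  have hPPi : P * Pi = ex := hPiE
  have hexle : ex ≤ 2 := by
    have : 1 / Real.log X ≤ 1 := by rw [div_le_one hlX0]; exact hlX1
    linarith
  -- assemble
  calc P * ∑ r ∈ dkBox L B R, MaynardDense.F₂ k (logVec R r) ^ 2 * wRatio L (∏ i, r i)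
      ≤ P * ((k : ℝ) ^ 2 * S₂) := mul_le_mul_of_nonneg_left hsum hP0.le
    _ ≤ P * ((k : ℝ) ^ 2 * (6 * Real.exp 4 * Piw * LI)) :=
        mul_le_mul_of_nonneg_left (mul_le_mul_of_nonneg_left hS2' (by positivity)) hP0.le
    _ = 6 * Real.exp 4 * (k : ℝ) ^ 2 * LI * (P * Piw) := by ring
    _ ≤ 6 * Real.exp 4 * (k : ℝ) ^ 2 * LI * (P * ((4 : ℝ) ^ 12 * Pi)) :=
        mul_le_mul_of_nonneg_left (mul_le_mul_of_nonneg_left hPiwle hP0.le) (by positivity)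
    _ = 6 * Real.exp 4 * 4 ^ 12 * (k : ℝ) ^ 2 * LI * (P * Pi) := by ring
    _ ≤ 6 * Real.exp 4 * 4 ^ 12 * (k : ℝ) ^ 2 * LI * 2 := by
        rw [hPPi]; exact mul_le_mul_of_nonneg_left hexle (by positivity)
    _ = 12 * Real.exp 4 * 4 ^ 12 * (k : ℝ) ^ 2 * Real.log R ^ k * MaynardDense.IF k := by
        rw [hLI]; ring

end FGKMT2018

/-- **The named fact `Maynard2016Prop91SwBound` holds** (the `E_diff` sum of the proof of Prop. 9.1
by Lemma 8.4 at scale `R²`). [cite: Maynard2016DenseClusters, proof of Prop. 9.1 p. 20; FordGreenKonyaginMaynardTao2018, Thm 6 (7.12)] -/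
theorem maynard2016Prop91SwBound_holds : Maynard2016Prop91SwBound :=
  FGKMT2018.prop91_swBound_frame

/-- **Maynard's Proposition 9.1 in the frame of FGKMT's Proposition 6.1 / Theorem 6 (7.12)**: the DAG
leaf `Maynard2016DenseClusters_prop91Z` — for some absolute `C, K`, eventually in `x`, uniformly in the
ranges of Prop. 6.1 and for `k ≥ C`,
`|∑_{n ∈ 𝒜(x)} w_n − mainTermA| ≤ K (log X)^{−1/10} · mainTermA`, `mainTermA = (B/φ(B))^k 𝔖_B(𝓛) #𝒜(x) (log R)^k I_k(F)`.
[cite: Maynard2016DenseClusters, Prop. 9.1 pp. 19–20 with Lemmas 8.1–8.6; FordGreenKonyaginMaynardTao2018, Thm 6 (7.12) pp. 21–23] -/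
theorem maynard2016DenseClusters_prop91Z_holds : Maynard2016DenseClusters_prop91Z :=
  maynard2016DenseClusters_prop91Z_of_swBound maynard2016Prop91SwBound_holds

end Literature.NumberTheory.Sieve
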